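import Literature.MathematicalPhysics.QuantumFieldTheory.Balaban1983to89.Node00.TorusCoverLandau153RecTowerGrad
import Literature.MathematicalPhysics.QuantumFieldTheory.Balaban1983to89.Node00.TorusCoverLandau153RecTowerDoor

/-!
# NODE 00 — THE R7 DOOR, STAGE 2 WITH THE ALL-LEVELS GRADIENT LETTER PASSED THROUGH (pen (j-iii) «(T2b)», second link): the window push-down
# `exists_localGauge152_recTower_window_member` (g10) VERBATIM, over STAGE 1's `_grad` twin, exporting for the member gauge `u_m` the ℤᵈ-side (152) member-2 letters at EVERY level
# and the crown's `(−2)` row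

Cell `pub-ymgap`, width seat `pub-ymgap-dag-n07-w3` g12 (plan g93 WORD A3⁵, pen (j-iii) = (T2b)).  NEW leaf, ONE theorem; CONSUMED BY NAME, nothing modified: g10's STAGE 2
`Node00.TorusCoverLandau153RecTowerDoor` (its statement and proof verbatim; `cover_shift_add_e ∕ _sub_e`, `codiffCurlA_coverShift_eq_pdiv_of_window`,
`lap_coverShift_eq_covLap_of_window`), this seat's STAGE 1 twin `Node00.TorusCoverLandau153RecTowerGrad.exists_suGauge_letters152_recTower_member_grad`.
`--kind proof --supports stmt-QuantumFields-20541` (K0⁷; count-neutral).  [6] = [Balaban1985RegularSpaces]; [15] = [Balaban1985Variational]; [I] = [Balaban1987RG1].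

WHY ∕ WHAT.  See `TorusCoverLandau153RecTowerGrad`'s header: the two new conjuncts are ℤᵈ-side statements about the EXPORTED `u_m`, so they pass through the torus push-down
untouched (the torus reading on `regionOfSet(π″□_{j′}).dpairs` is done at the knit, where the level windows are the print datum's `cube … j j′`).  ★★
`exists_localGauge152_recTower_window_member_grad` — statement = g10's + the two conjuncts; proof = g10's verbatim with STAGE 1 ↦ STAGE 1-grad and two tuple entries.
HONEST FRAMING: count-neutral; bookkeeping; nothing of [6]∕[15]∕[I] asserted; (T2b) itself NOT yet typed; `HThm4Rec*` premises CONDITIONAL; N05 ∕ N07 NOT discharged; COUNT 8∕27 ·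
K 1∕4 UNMOVED; one finite 𝕋⁴ programme at fixed ε — R4 closes the conditional finite-𝕋⁴ rung `BalabanLadder.UV` only; the YM mass gap (Clay) is NOT proved by any of this; nothing
continuum ∕ ℝ⁴ ∕ OS.  No `def`, no `instance`, no `notation`, no `sorry`.

[cite: Balaban1985Variational, (144)–(153) pp.300–301; Balaban1985RegularSpaces, Prop. 6 (1.135)–(1.138) p.99, (1.29) p.81, (1.131) p.99, p.98; Balaban1985Averaging, (78)–(81) p.30; Balaban1987RG1, (0.1) p.251, (0.3)–(0.4) pp.252–253]
-/

noncomputable section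

namespace Literature.MathematicalPhysics.QuantumFieldTheory.Balaban1983to89.Node00

open scoped Matrix.Norms.L2Operator
open Complex (I)
open B7Prop1Explicit (e e_apply gaugeAct)
open B7Prop1Local (InBox AgreeOn)
open B7Prop2Explicit (unitaryUnits mem_unitaryUnits)
open B7Prop2SpecialUnitary (specialUnitaryUnits mem_specialUnitaryUnits)
open BlockAveragingZd (avgIterZ ctrShift)
open B8Ineq132 (covDerivFwd covDeriv BondTouches)
open B8Eq131Cubes (tLo tHi ctr gs)
open B8Eq131CubesRec (boxZ cubeZ tcubeZ bLoZ bHiZ)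
open B8Eq140Level (SideTouches)
open B8Eq138LandauZd (logCfg covDivB covLap)
open B8Eq138LandauZdRec (IsLandau138Z IsLandau138WZ)
open B8Eq119TwistedAxialRec (Restr129Z)
open B7SectEFLinearisationRec (logCovIterZ)
open B8Eq184Proof (cfgExp)
open B8LeafModelZd3 (mlogCfg)
open B8ScaledSupNorm (msup Bdd bondNorm)
open B8Eq146AExpansion (plaqCovDeriv iEta)
open B8Eq143PlaqExpansion (pdiv)
open MatrixLog (mlog)
open B15Eq112TorusCover (cover)
open B14DomainGeom (Pt)
open B12RegularSpaces111 (gaugeU expI grad)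

variable {P : Params} {N : ℕ} [NeZero N]

section DoorGrad

/-- ★★ **STAGE 2 OF THE R7 DOOR WITH THE ALL-LEVELS GRADIENT LETTER AND THE `(−2)` ROW PASSED THROUGH** — g10's `exists_localGauge152_recTower_window_member` VERBATIM plus,
for the exported `u_m`: (xiv′) `∀ j ≤ k, ∀ x μ ν, x, x + e_μ ∈ Ω′_j → ‖A′(x + e_μ, ν) − A′(x, ν)‖ ≤ 2·(η·r·((Lʲη)²)⁻¹)` (`A′ = logCfg η_n (U₀″^{u_m⁻¹})`), (xv′) `msup … (−2) … ≤ r`.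
[cite: Balaban1985Variational, (144)–(153) pp.300–301; Balaban1985RegularSpaces, Prop. 6 (1.135)–(1.138) p.99, (1.29) p.81, (1.131) p.99; Balaban1985Averaging, (78)–(81) p.30; Balaban1987RG1, (0.3)–(0.4) pp.252–253] -/
theorem exists_localGauge152_recTower_window_member_grad (hd : 2 ≤ P.d) {K' : ℕ} {Ω' : ℕ → Set (B7Prop1Explicit.Site P.d)} (c : CubeB8DZ P.d P.L K' Ω')
    (U : GaugeField P 0 (SU N)) (t : Pt P.d) {n : ℕ} (hk : c.k = n) {r : ℝ} (hr : 0 ≤ r)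
    (hG : letI : CStarAlgebra (MatA N) := {};
      ∃ u : B7Prop1Explicit.Site P.d → (MatA N)ˣ, (∀ x, u x ∈ specialUnitaryUnits (Fin N)) ∧ (∀ x, x ∉ c.sq 0 → u x = 1) ∧
        Restr129Z P.L c.k c.lamS (1 : B7Prop1Explicit.Site P.d → Fin P.d → (MatA N)ˣ) u ∧
        IsLandau138WZ P.L c.k (P.eta n) (c.sq 0) c.lamS (1 : B7Prop1Explicit.Site P.d → Fin P.d → (MatA N)ˣ)
          (c.fixed (fun x μ => ιSU N (U ⟨cover P (x + t), μ⟩)) u) ∧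
        (∀ j, j ≤ c.k → ∀ b ∈ {b : B7Prop1Explicit.Site P.d × Fin P.d | SideTouches (c.sq j) b.1 b.2},
          c.fixed (fun x μ => ιSU N (U ⟨cover P (x + t), μ⟩)) u b.1 b.2 =
              cfgExp (P.eta n) (logCfg (P.eta n) (c.fixed (fun x μ => ιSU N (U ⟨cover P (x + t), μ⟩)) u)) b.1 b.2 ∧
            IsSelfAdjoint (logCfg (P.eta n) (c.fixed (fun x μ => ιSU N (U ⟨cover P (x + t), μ⟩)) u) b.1 b.2) ∧
            ‖logCfg (P.eta n) (c.fixed (fun x μ => ιSU N (U ⟨cover P (x + t), μ⟩)) u) b.1 b.2‖ ≤ r * ((P.L : ℝ) ^ j * P.eta n)⁻¹) ∧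
        (∀ x, ((c.vfix (fun x μ => ιSU N (U ⟨cover P (x + t), μ⟩)))⁻¹ * u) x ∈ specialUnitaryUnits (Fin N)) ∧
        AgreeOn (B8Ineq130Rec.tlo P.L (tLo c.a c.ρ) c.k) (B8Ineq130Rec.thi P.L (tHi c.a c.M c.ρ) c.k)
          (gaugeAct ((c.vfix (fun x μ => ιSU N (U ⟨cover P (x + t), μ⟩)))⁻¹ * u)⁻¹ (fun x μ => ιSU N (U ⟨cover P (x + t), μ⟩)))
          (c.fixed (fun x μ => ιSU N (U ⟨cover P (x + t), μ⟩)) u) ∧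
        msup P.L c.k (P.eta n) (-(2 : ℝ)) (fun j (q : Fin P.d × Fin P.d × B7Prop1Explicit.Site P.d) => SideTouches (c.sq j) q.2.2 q.2.1)
            (fun q => covDerivFwd (P.eta n) (1 : B7Prop1Explicit.Site P.d → Fin P.d → (MatA N)ˣ) q.1
              (fun z => c.expo (P.eta n) (fun x μ => ιSU N (U ⟨cover P (x + t), μ⟩)) u z q.2.1) q.2.2) ≤ r ∧
        bondNorm P.L c.k (P.eta n) (-(3 : ℝ)) c.sq
            (fun x μ => pdiv (P.eta n) (1 : B7Prop1Explicit.Site P.d → Fin P.d → (MatA N)ˣ)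
              (plaqCovDeriv (P.eta n) (1 : B7Prop1Explicit.Site P.d → Fin P.d → (MatA N)ˣ)
                (c.expo (P.eta n) (fun x μ => ιSU N (U ⟨cover P (x + t), μ⟩)) u)) μ x) ≤ r ∧
        bondNorm P.L c.k (P.eta n) (-(3 : ℝ)) c.sq
            (fun x μ => covLap (P.eta n) (1 : B7Prop1Explicit.Site P.d → Fin P.d → (MatA N)ˣ)
              (fun z => c.expo (P.eta n) (fun x μ => ιSU N (U ⟨cover P (x + t), μ⟩)) u z μ) x) ≤ r ∧
        (∀ (x : B7Prop1Explicit.Site P.d) (μ : Fin P.d), bLoZ P.L c.a 0 0 ≤ x → x + e μ ≤ bHiZ P.L c.a c.M 0 0 → c.inTop x → c.inTop (x + e μ) →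
          logCovIterZ P.L (1 : B7Prop1Explicit.Site P.d → Fin P.d → (MatA N)ˣ)
              (iEta (P.eta n) (c.expo (P.eta n) (fun x μ => ιSU N (U ⟨cover P (x + t), μ⟩)) u)) c.k x μ =
            mlog ((avgIterZ P.L (c.axial (fun x μ => ιSU N (U ⟨cover P (x + t), μ⟩))) c.k x μ : (MatA N)ˣ) : MatA N)))
    {X Xt X' : Set (Pt P.d)} (hXX' : X ⊆ X') (hXt : Xt ⊆ X) (hsq0X' : c.sq 0 ⊆ X') (hinj' : Set.InjOn (fun x => cover P (x + t)) X')
    (hfwd : ∀ ⦃x⦄, x ∈ X → ∀ μ, (cover P (x + t)).shift μ ∈ (fun x => cover P (x + t)) '' X → x + e μ ∈ X)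
    (hfwdt : ∀ ⦃x⦄, x ∈ Xt → ∀ μ, (cover P (x + t)).shift μ ∈ (fun x => cover P (x + t)) '' Xt → x + e μ ∈ Xt)
    (hbwdt : ∀ ⦃x⦄, x ∈ Xt → ∀ ν, (cover P (x + t)).unshift ν ∈ (fun x => cover P (x + t)) '' Xt → x - e ν ∈ Xt)
    (hsq : X ⊆ c.sq 0) (hbox : Xt ⊆ cubeZ P.L c.a c.M c.ρ c.k c.k)
    (h4 : 4 * ((N : ℝ) * r) < 2 * Real.pi) :
    letI : CStarAlgebra (MatA N) := {}
    ∃ u : GaugeTransf P 0 (SU N), ∃ A : PBond P 0 → MatA N, ∃ um : B7Prop1Explicit.Site P.d → (MatA N)ˣ,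
      (∀ b ∈ (Sect2.regionOfSet P ((fun x => cover P (x + t)) '' X)).bonds, gaugeU (fun x => ιSU N (u x)) (fun b' => ιSU N (U b')) b = expI (P.eta n) (A b)) ∧
      (∀ j, j ≤ c.k → ∀ (x : Pt P.d) (μ : Fin P.d), x ∈ X → x + e μ ∈ X → x ∈ c.sq j → x + e μ ∈ c.sq j →
          ‖A ⟨cover P (x + t), μ⟩‖ ≤ 2 * (r * ((P.L : ℝ) ^ j * P.eta n)⁻¹)) ∧
      (∀ b ∈ (Sect2.regionOfSet P ((fun x => cover P (x + t)) '' Xt)).bonds, ‖A b‖ ≤ 2 * (r * P.L)) ∧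
      (∀ q ∈ (Sect2.regionOfSet P ((fun x => cover P (x + t)) '' Xt)).dpairs, ‖grad (P.eta n) q.2.1 (fun y => A ⟨y, q.2.2⟩) q.1‖ ≤ 2 * (r * (P.L : ℝ) ^ 2)) ∧
      (∀ b ∈ Sect2.bondsDeep ((fun x => cover P (x + t)) '' Xt), ‖Sect2.codiffCurlA (P.eta n) A b.src b.dir‖ ≤ 2 * (r * (P.L : ℝ) ^ 3)) ∧
      (∀ b ∈ Sect2.bondsDeep ((fun x => cover P (x + t)) '' Xt),
          ‖∑ ν : Fin P.d, ((P.eta n : ℝ) : ℂ)⁻¹ •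
              (grad (P.eta n) ν (fun y => A ⟨y, b.dir⟩) (b.src.unshift ν) - grad (P.eta n) ν (fun y => A ⟨y, b.dir⟩) b.src)‖ ≤ 2 * (r * (P.L : ℝ) ^ 3)) ∧
      (∀ x, x ∈ X' → ∀ μ, A ⟨cover P (x + t), μ⟩ = logCfg (P.eta n) (c.fixed (fun x μ => ιSU N (U ⟨cover P (x + t), μ⟩)) um) x μ) ∧
      IsLandau138Z P.L c.k (P.eta n) (c.sq 0) c.lamS (1 : B7Prop1Explicit.Site P.d → Fin P.d → (MatA N)ˣ)
        (logCfg (P.eta n) (c.fixed (fun x μ => ιSU N (U ⟨cover P (x + t), μ⟩)) um)) ∧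
      (∀ x, x ∈ c.sq 0 → ιSU N (u (cover P (x + t))) = (um x)⁻¹ * c.vfix (fun x μ => ιSU N (U ⟨cover P (x + t), μ⟩)) x) ∧
      (∀ x, um x ∈ specialUnitaryUnits (Fin N)) ∧ (∀ x, x ∉ c.sq 0 → um x = 1) ∧
      Restr129Z P.L c.k c.lamS (1 : B7Prop1Explicit.Site P.d → Fin P.d → (MatA N)ˣ) um ∧
      (∀ (x : B7Prop1Explicit.Site P.d) (μ : Fin P.d), bLoZ P.L c.a 0 0 ≤ x → x + e μ ≤ bHiZ P.L c.a c.M 0 0 → c.inTop x → c.inTop (x + e μ) →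
        logCovIterZ P.L (1 : B7Prop1Explicit.Site P.d → Fin P.d → (MatA N)ˣ)
            (iEta (P.eta n) (c.expo (P.eta n) (fun x μ => ιSU N (U ⟨cover P (x + t), μ⟩)) um)) c.k x μ =
          mlog ((avgIterZ P.L (c.axial (fun x μ => ιSU N (U ⟨cover P (x + t), μ⟩))) c.k x μ : (MatA N)ˣ) : MatA N)) ∧
      -- ★ NEW (T2b input, ℤᵈ side, passed through): (152) member 2 at EVERY level for the exported `um`
      (∀ j, j ≤ c.k → ∀ (x : B7Prop1Explicit.Site P.d) (μ ν : Fin P.d), x ∈ c.sq j → x + e μ ∈ c.sq j →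
          ‖logCfg (P.eta n) (c.fixed (fun x μ => ιSU N (U ⟨cover P (x + t), μ⟩)) um) (x + e μ) ν
              - logCfg (P.eta n) (c.fixed (fun x μ => ιSU N (U ⟨cover P (x + t), μ⟩)) um) x ν‖ ≤
            2 * (P.eta n * r * (((P.L : ℝ) ^ j * P.eta n) ^ 2)⁻¹)) ∧
      -- ★ NEW (pass-through): the crown's `(−2)` row for `um`
      msup P.L c.k (P.eta n) (-(2 : ℝ)) (fun j (q : Fin P.d × Fin P.d × B7Prop1Explicit.Site P.d) => SideTouches (c.sq j) q.2.2 q.2.1)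
          (fun q => covDerivFwd (P.eta n) (1 : B7Prop1Explicit.Site P.d → Fin P.d → (MatA N)ˣ) q.1
            (fun z => c.expo (P.eta n) (fun x μ => ιSU N (U ⟨cover P (x + t), μ⟩)) um z q.2.1) q.2.2) ≤ r := by
  classical
  letI : CStarAlgebra (MatA N) := {}
  have hLo : Odd P.L := P.hL.1
  have hL : 2 ≤ P.L := P.hL.2
  have hηpos : 0 < P.eta n := B3GkZeroTorusRescaled.eta_pos P n
  set V : B7Prop1Explicit.Site P.d → Fin P.d → (MatA N)ˣ := fun x μ => ιSU N (U ⟨cover P (x + t), μ⟩) with hV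
  have hVsu : ∀ x μ, V x μ ∈ specialUnitaryUnits (Fin N) := fun x μ => by
    rw [hV]; exact mem_specialUnitaryUnits.2 (U ⟨cover P (x + t), μ⟩).2
  obtain ⟨s, um, h1, hlev, h2, h3, h4c, h4', h5, hsid, hsu, hoff, h129, h137, hgradAll, hmsup⟩ :=
    exists_suGauge_letters152_recTower_member_grad hd hLo hL c V hVsu hηpos hr hG h4
  -- the scale of the dent's level: `L^{k−1}·η_n = L⁻¹`, `Lᵏ·η_n = 1`
  have hscale : (P.L : ℝ) ^ c.k * P.eta n = 1 := by rw [hk]; exact B12Eq115BackgroundPair.pow_mul_eta P n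
  have hLpos : (0 : ℝ) < P.L := by exact_mod_cast P.L_pos
  have hscale' : (P.L : ℝ) ^ (c.k - 1) * P.eta n = (P.L : ℝ)⁻¹ := by
    have hk1 : c.k - 1 + 1 = c.k := Nat.sub_add_cancel c.one_le_k
    have h : (P.L : ℝ) ^ c.k = (P.L : ℝ) ^ (c.k - 1) * P.L := by rw [← pow_succ, hk1]
    have h' : (P.L : ℝ) ^ (c.k - 1) * P.eta n * P.L = 1 := by rw [mul_right_comm, ← h, hscale]
    exact eq_inv_of_mul_eq_one_left h'
  simp only [hscale', inv_inv, inv_pow] at h2 h3 h4c h4'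
  set A' : B7Prop1Explicit.Site P.d → Fin P.d → MatA N := logCfg (P.eta n) (c.fixed V um) with hA'
  have hinjt : Set.InjOn (fun x => cover P (x + t)) Xt := hinj'.mono (hXt.trans hXX')
  -- push-down through the translated cover, injective on the LARGE window `X′`
  let u : GaugeTransf P 0 (SU N) := fun y =>
    if h : ∃ x, x ∈ X' ∧ cover P (x + t) = y then s (Classical.choose h) else 1
  let A : PBond P 0 → MatA N := fun b =>
    if h : ∃ x, x ∈ X' ∧ cover P (x + t) = b.src then A' (Classical.choose h) b.dir else 0
  have hu : ∀ x, x ∈ X' → u (cover P (x + t)) = s x := by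
    intro x hx
    have hex : ∃ x', x' ∈ X' ∧ cover P (x' + t) = cover P (x + t) := ⟨x, hx, rfl⟩
    simp only [u, dif_pos hex]
    rw [hinj' (Classical.choose_spec hex).1 hx (Classical.choose_spec hex).2]
  have hA : ∀ x, x ∈ X' → ∀ μ, A ⟨cover P (x + t), μ⟩ = A' x μ := by
    intro x hx μ
    have hex : ∃ x', x' ∈ X' ∧ cover P (x' + t) = cover P (x + t) := ⟨x, hx, rfl⟩
    simp only [A, dif_pos hex]
    rw [hinj' (Classical.choose_spec hex).1 hx (Classical.choose_spec hex).2]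
  have hlift : ∀ y, y ∈ (fun x => cover P (x + t)) '' X → ∃ x, x ∈ X ∧ cover P (x + t) = y := fun y ⟨x, hx, hxy⟩ => ⟨x, hx, hxy⟩
  have hliftt : ∀ y, y ∈ (fun x => cover P (x + t)) '' Xt → ∃ x, x ∈ Xt ∧ cover P (x + t) = y := fun y ⟨x, hx, hxy⟩ => ⟨x, hx, hxy⟩
  have hXtX' : Xt ⊆ X' := hXt.trans hXX'
  have hL1 : (1 : ℝ) ≤ P.L := by exact_mod_cast P.L_pos
  refine ⟨u, A, um, fun b hb => ?_, fun j hj x μ hx hx' hxj hxj' => ?_, fun b hb => ?_, fun q hq => ?_, fun b hb => ?_, fun b hb => ?_, hA, h5,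
    fun x hx => ?_, hsu, hoff, h129, h137, hgradAll, hmsup⟩
  · obtain ⟨x, hx, hxs⟩ := hlift b.src hb.1
    have hx' : x + e b.dir ∈ X := hfwd hx b.dir (by rw [hxs]; exact hb.2)
    have hb' : b = ⟨cover P (x + t), b.dir⟩ := by cases b; simp only at hxs; rw [hxs]
    rw [hb', hA x (hXX' hx)]
    have hgauge := h1 x b.dir (hsq hx) (hsq hx')
    rw [cfgExp_eq_expI] at hgauge
    rw [← hgauge]
    simp only [gaugeU, B7Prop1Explicit.gaugeAct, PBond.tgt, ← cover_shift_add_e, hu x (hXX' hx), hu (x + e b.dir) (hXX' hx'), hV]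
  · rw [hA x (hXX' hx)]
    exact hlev j hj x μ hxj hxj'
  · obtain ⟨x, hx, hxs⟩ := hliftt b.src hb.1
    have hx' : x + e b.dir ∈ Xt := hfwdt hx b.dir (by rw [hxs]; exact hb.2)
    have hb' : b = ⟨cover P (x + t), b.dir⟩ := by cases b; simp only at hxs; rw [hxs]
    rw [hb', hA x (hXtX' hx)]
    exact h2 x b.dir (hbox hx) (hbox hx')
  · obtain ⟨hq1, hq2, hq3, -⟩ := hq
    obtain ⟨x, hx, hxs⟩ := hliftt q.1 hq1
    have hxμ : x + e q.2.1 ∈ Xt := hfwdt hx q.2.1 (by rw [hxs]; exact hq2)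
    have hxν : x + e q.2.2 ∈ Xt := hfwdt hx q.2.2 (by rw [hxs]; exact hq3)
    rw [grad, ← hxs, ← cover_shift_add_e, hA x (hXtX' hx), hA (x + e q.2.1) (hXtX' hxμ), norm_smul, norm_inv, Complex.norm_real, Real.norm_eq_abs,
      abs_of_pos hηpos]
    calc (P.eta n)⁻¹ * ‖A' (x + e q.2.1) q.2.2 - A' x q.2.2‖ ≤ (P.eta n)⁻¹ * (2 * (P.eta n * r * (P.L : ℝ) ^ 2)) :=
          mul_le_mul_of_nonneg_left (h3 x q.2.1 q.2.2 (hbox hx) (hbox hxμ) (hbox hxν)) (inv_nonneg.2 hηpos.le)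
      _ = 2 * (r * (P.L : ℝ) ^ 2) := by field_simp
  · obtain ⟨hb1, hb2, hbν⟩ := hb
    obtain ⟨x, hx, hxs⟩ := hliftt b.src hb1
    have hxμ : x + e b.dir ∈ Xt := hfwdt hx b.dir (by rw [hxs]; exact hb2)
    have hstencil : ∀ ν, x + e ν ∈ Xt ∧ x - e ν ∈ Xt ∧ x - e ν + e b.dir ∈ Xt := by
      intro ν
      obtain ⟨s1, s2, s3, s4⟩ := hbν ν
      have hxν : x + e ν ∈ Xt := hfwdt hx ν (by rw [hxs]; exact s1)
      have hxν' : x - e ν ∈ Xt := hbwdt hx ν (by rw [hxs]; exact s2)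
      have hxν'' : x - e ν + e b.dir ∈ Xt :=
        hfwdt hxν' b.dir (by
          rw [cover_shift_sub_e, hxs, ← Site.unshift_shift_comm]
          exact s4)
      exact ⟨hxν, hxν', hxν''⟩
    have hb' : b = ⟨cover P (x + t), b.dir⟩ := by cases b; simp only at hxs; rw [hxs]
    rw [hb']
    show ‖Sect2.codiffCurlA (P.eta n) A (cover P (x + t)) b.dir‖ ≤ 2 * (r * (P.L : ℝ) ^ 3)
    have hAX : ∀ z, z ∈ Xt → ∀ κ, A ⟨cover P (z + t), κ⟩ = A' z κ := fun z hz => hA z (hXtX' hz)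
    rw [codiffCurlA_coverShift_eq_pdiv_of_window (P.eta n) t hAX hx hxμ hstencil]
    exact h4c x b.dir (hbox hx) (hbox hxμ) fun ν => ⟨hbox (hstencil ν).1, hbox (hstencil ν).2.1, hbox (hstencil ν).2.2⟩
  · obtain ⟨hb1, hb2, hbν⟩ := hb
    obtain ⟨x, hx, hxs⟩ := hliftt b.src hb1
    have hxμ : x + e b.dir ∈ Xt := hfwdt hx b.dir (by rw [hxs]; exact hb2)
    have hstencil : ∀ ν, x + e ν ∈ Xt ∧ x - e ν ∈ Xt := by
      intro ν
      obtain ⟨s1, s2, -, -⟩ := hbν ν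
      exact ⟨hfwdt hx ν (by rw [hxs]; exact s1), hbwdt hx ν (by rw [hxs]; exact s2)⟩
    have hb' : b = ⟨cover P (x + t), b.dir⟩ := by cases b; simp only at hxs; rw [hxs]
    rw [hb']
    show ‖∑ ν : Fin P.d, ((P.eta n : ℝ) : ℂ)⁻¹ •
        (grad (P.eta n) ν (fun y => A ⟨y, b.dir⟩) ((cover P (x + t)).unshift ν) - grad (P.eta n) ν (fun y => A ⟨y, b.dir⟩) (cover P (x + t)))‖ ≤
          2 * (r * (P.L : ℝ) ^ 3)
    have hAX : ∀ z, z ∈ Xt → ∀ κ, A ⟨cover P (z + t), κ⟩ = A' z κ := fun z hz => hA z (hXtX' hz)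
    rw [lap_coverShift_eq_covLap_of_window (P.eta n) t hAX hx hstencil]
    exact h4' x b.dir (hbox hx) (hbox hxμ) fun ν => ⟨hbox (hstencil ν).1, hbox (hstencil ν).2⟩
  · rw [hu x (hsq0X' hx)]
    exact hsid x hx

end DoorGrad

end Literature.MathematicalPhysics.QuantumFieldTheory.Balaban1983to89.Node00

end

/-! ## Axiom audit (gate whitelist: `propext`, `Classical.choice`, `Quot.sound`) -/
#print axioms Literature.MathematicalPhysics.QuantumFieldTheory.Balaban1983to89.Node00.exists_localGauge152_recTower_window_member_grad
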